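import Summits.NavierStokesRegularity.NavierStokesRegularity.Theorems.SelfMixingDichotomyCoherentScaleExclusionConverse
import Summits.NavierStokesRegularity.NavierStokesRegularity.Theorems.SelfMixingDichotomySequentialTypeIExclusionQuantPayoffSummit
import Literature.Analysis.FluidPDE.DissipatesAtScale

/-!
# Route SelfMixingDichotomy — crux `CoherentScaleExclusion` (S2, item stmt-NavierStokesRegularity-1423):
# the regime cut is lossless, and the unbounded-load form of the crux

Pure logic over landed lemmas, `--supports stmt-NavierStokesRegularity-1423` (line lead c2 of
`Cruxes/CoherentScaleExclusion/Lines/birth.lean`). Notation as in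
`SelfMixingDichotomyCoherentScaleExclusionStructure`: `C(r) = cknC r (T,x₀) u`, `MIX(r,δ)` =
`DissipatesAtScale u T x₀ r δ` (definitionally the formula inlined in the route file), `Recur(M,δ)` = "for every
`r₀ > 0` some `r ∈ (0,r₀)` has `ofReal M ≤ C(r)` and `¬ MIX(r,δ)`", `BDD` = "`u` bounded on some
`(T-ρ²,T) × B_ρ(x₀)`"; (A), (I), (B) are the STATEMENTS of the three registered regime stubs of the birth line
(Type-I ceiling / windows with unbounded load / pure cascade), for all `δ > 0` (the registered stubs carry the
harmless extra hypothesis `δ < 1`).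

## Contents

* `coherentTypeIRegime_of_coherentScaleExclusion : S2 → (A)`, `coherentWindowRegime_of_coherentScaleExclusion :
  S2 → (I)` (S2 ignores the extra regime hypotheses; in (I) boundedness caps the load), and with the landed
  `cascadeRegime_of_coherentScaleExclusion : S2 → (B)` and `coherentScaleExclusion_of_regimes`:
  `coherentScaleExclusion_iff_regimes : S2 ↔ (A) ∧ (I) ∧ (B)` — THE BIRTH CUT IS LOSSLESS: no line for S2 can
  avoid any of the three regimes; in particular every line must prove the cascade stub (B).
* The UNBOUNDED-LOAD FORM `S2_unb` of the crux: for every `δ > 0` there is `M` such that no final-time point of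
  a finite-energy classical solution from a rapidly decaying datum has unbounded load (`∀ M'' ∀ r₁ > 0 ∃ r < r₁,
  ofReal M'' < C(r)`, i.e. `limsup_{r→0} C(r) = ∞`) together with `Recur(M,δ)`.
  `unboundedLoadExclusion_of_coherentScaleExclusion : S2 → S2_unb`;
  `unboundedLoadExclusion_iff_regimes : S2_unb ↔ (I) ∧ (B)`;
  `coherentScaleExclusion_of_unboundedLoadExclusion_of_supForm : S2_unb → S1_sup → S2`, where `S1_sup` is the
  sup-form of the sibling crux S1 (final-time centred Type-I exclusion: a load CEILING near `0` forces `BDD`),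
  which the tree derives from `¬ TypeISingularityExists` (`supForm_of_not_typeISingularityExists`);
  hence `coherentScaleExclusion_iff_unboundedLoadExclusion_of_supForm : S1_sup → (S2 ↔ S2_unb)`.
* Route level. The S1 lead's restated thesis `P_quant ∧ S2 ∧ S1_sup` (`bdd_of_quantMixingPayoff`,
  `navierStokesRegularity_of_quantMixingPayoff`) needs S2 only in its unbounded-load form:
  `bdd_of_quantMixingPayoff_of_unboundedLoadExclusion : P_quant → S2_unb → S1_sup → BDD everywhere` and
  `navierStokesRegularity_of_quantMixingPayoff_of_unboundedLoadExclusion :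
  P_quant → S2_unb → ¬ TypeISingularityExists → NavierStokesRegularity`.
  So in the restated route the structure crux can be filed as `S2_unb ⇔ (I) ∧ (B)`: regime (A) of S2 is
  carried by `S1_sup`; what remains is "at a point of unbounded load, `δ`-coherent `M`-loaded scales do not
  recur" — open and dynamical. Nothing here is new mathematics.
-/

noncomputable section

namespace Summit.NavierStokesRegularity.NavierStokesRegularity.Theorems

-- single-conjunct summit (`<Problem> = <Summit>`): the duplicated namespace component is by design
set_option linter.dupNamespace false

open MeasureTheory Filter Set Metric
open Literature.Analysis.FluidPDE
open Summit.NavierStokesRegularity.NavierStokesRegularity.Theses.SelfMixingDichotomy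

/-- Unbounded load near `0` is incompatible with a load ceiling near `0`. [folklore] -/
theorem coherentScaleExclusion_not_loadCeiling_of_unboundedLoad
    {u : ℝ → EuclideanSpace ℝ (Fin 3) → EuclideanSpace ℝ (Fin 3)} {T : ℝ} {x₀ : EuclideanSpace ℝ (Fin 3)}
    (hunb : ∀ M'' r₁ : ℝ, 0 < r₁ → ∃ r ∈ Set.Ioo 0 r₁,
        ENNReal.ofReal M'' < cknC r ((T, x₀) : ℝ × EuclideanSpace ℝ (Fin 3)) u)
    (hceil : ∃ M₁ r₁ : ℝ, 0 < r₁ ∧ ∀ r ∈ Set.Ioo 0 r₁,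
        cknC r ((T, x₀) : ℝ × EuclideanSpace ℝ (Fin 3)) u ≤ ENNReal.ofReal M₁) : False := by
  obtain ⟨M₁, r₁, hr₁, hC⟩ := hceil
  obtain ⟨r, hr, hlt⟩ := hunb M₁ r₁ hr₁
  exact lt_irrefl _ (hlt.trans_le (hC r hr))

/-- In a pure cascade (`C(r) → ∞` along all small scales) the load is unbounded near `0`. [folklore] -/
theorem coherentScaleExclusion_unboundedLoad_of_cascade
    {u : ℝ → EuclideanSpace ℝ (Fin 3) → EuclideanSpace ℝ (Fin 3)} {T : ℝ} {x₀ : EuclideanSpace ℝ (Fin 3)}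
    (hcasc : ∀ M' : ℝ, ∃ r₁ : ℝ, 0 < r₁ ∧ ∀ r ∈ Set.Ioo 0 r₁,
        ENNReal.ofReal M' ≤ cknC r ((T, x₀) : ℝ × EuclideanSpace ℝ (Fin 3)) u) :
    ∀ M'' r₁ : ℝ, 0 < r₁ → ∃ r ∈ Set.Ioo 0 r₁,
        ENNReal.ofReal M'' < cknC r ((T, x₀) : ℝ × EuclideanSpace ℝ (Fin 3)) u := by
  intro M'' r₁ hr₁
  obtain ⟨r₂, hr₂, hload⟩ := hcasc (max M'' 0 + 1)
  have hmin : 0 < min r₁ r₂ := lt_min hr₁ hr₂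
  refine ⟨min r₁ r₂ / 2, ⟨by positivity, by linarith [min_le_left r₁ r₂]⟩, ?_⟩
  have hr : min r₁ r₂ / 2 ∈ Set.Ioo 0 r₂ := ⟨by positivity, by linarith [min_le_right r₁ r₂]⟩
  refine lt_of_lt_of_le ?_ (hload _ hr)
  calc ENNReal.ofReal M'' ≤ ENNReal.ofReal (max M'' 0) := ENNReal.ofReal_le_ofReal (le_max_left _ _)
    _ < ENNReal.ofReal (max M'' 0 + 1) :=
        (ENNReal.ofReal_lt_ofReal_iff (by positivity)).2 (lt_add_one _)

/-- Trichotomy bookkeeping: if the load is not a pure cascade, bounded-load scales recur. [folklore] -/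
theorem coherentScaleExclusion_windows_of_not_cascade
    {u : ℝ → EuclideanSpace ℝ (Fin 3) → EuclideanSpace ℝ (Fin 3)} {T : ℝ} {x₀ : EuclideanSpace ℝ (Fin 3)}
    (hcasc : ¬ ∀ M' : ℝ, ∃ r₁ : ℝ, 0 < r₁ ∧ ∀ r ∈ Set.Ioo 0 r₁,
        ENNReal.ofReal M' ≤ cknC r ((T, x₀) : ℝ × EuclideanSpace ℝ (Fin 3)) u) :
    ∃ M' : ℝ, ∀ r₁ : ℝ, 0 < r₁ → ∃ r ∈ Set.Ioo 0 r₁,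
        cknC r ((T, x₀) : ℝ × EuclideanSpace ℝ (Fin 3)) u ≤ ENNReal.ofReal M' := by
  push Not at hcasc
  obtain ⟨M', hM'⟩ := hcasc
  exact ⟨M', fun r₁ hr₁ => (hM' r₁ hr₁).imp fun r hr => ⟨hr.1, hr.2.le⟩⟩

/-- Trichotomy bookkeeping: if there is no load ceiling near `0`, the load is unbounded near `0`. [folklore] -/
theorem coherentScaleExclusion_unboundedLoad_of_not_loadCeiling
    {u : ℝ → EuclideanSpace ℝ (Fin 3) → EuclideanSpace ℝ (Fin 3)} {T : ℝ} {x₀ : EuclideanSpace ℝ (Fin 3)}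
    (hceil : ¬ ∃ M₁ r₁ : ℝ, 0 < r₁ ∧ ∀ r ∈ Set.Ioo 0 r₁,
        cknC r ((T, x₀) : ℝ × EuclideanSpace ℝ (Fin 3)) u ≤ ENNReal.ofReal M₁) :
    ∀ M'' r₁ : ℝ, 0 < r₁ → ∃ r ∈ Set.Ioo 0 r₁,
        ENNReal.ofReal M'' < cknC r ((T, x₀) : ℝ × EuclideanSpace ℝ (Fin 3)) u := by
  push Not at hceil
  exact fun M'' r₁ hr₁ => hceil M'' r₁ hr₁

/-- **S2 implies its Type-I regime (A)** — the statement of the registered stub `stub_coherentTypeIExclusion`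
without the restriction `δ < 1`: S2 concludes `BDD` from `Recur(M,δ)` alone, the ceiling hypothesis is not
needed. [folklore] -/
theorem coherentTypeIRegime_of_coherentScaleExclusion (hS2 : CoherentScaleExclusion) :
    ∀ δ : ℝ, 0 < δ → ∃ M : ℝ, ∀ T : ℝ, 0 < T →
      ∀ (u : ℝ → EuclideanSpace ℝ (Fin 3) → EuclideanSpace ℝ (Fin 3)) (p : ℝ → EuclideanSpace ℝ (Fin 3) → ℝ),
      IsClassicalNSSolutionOn (Set.Ico 0 T) 1 0 u p →
      IsLerayHopfOn T 1 0 (u 0) u →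
      HasRapidSpatialDecay (u 0) →
      ∀ x₀ : EuclideanSpace ℝ (Fin 3),
      (∃ M₁ r₁ : ℝ, 0 < r₁ ∧ ∀ r ∈ Set.Ioo 0 r₁,
          cknC r ((T, x₀) : ℝ × EuclideanSpace ℝ (Fin 3)) u ≤ ENNReal.ofReal M₁) →
      (∀ r₀ : ℝ, 0 < r₀ → ∃ r ∈ Set.Ioo 0 r₀,
          ENNReal.ofReal M ≤ cknC r ((T, x₀) : ℝ × EuclideanSpace ℝ (Fin 3)) u ∧
          ¬ DissipatesAtScale u T x₀ r δ) →
      (∃ ρ : ℝ, 0 < ρ ∧ ∃ M : ℝ, ∀ t ∈ Set.Ioo (T - ρ ^ 2) T, ∀ x ∈ Metric.ball x₀ ρ, ‖u t x‖ ≤ M) := by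
  intro δ hδ
  obtain ⟨M, hM⟩ := hS2 δ hδ
  exact ⟨M, fun T hT u p hcl hLH hdec x₀ _ hrec => hM T hT u p hcl hLH hdec x₀ hrec⟩

/-- **S2 implies its window regime (I)** — the statement of the registered stub `stub_coherentWindowExclusion`
without the restriction `δ < 1`: S2 gives `BDD` from `Recur(M,δ)`, and `BDD` caps the load near `0`
(`coherentScaleExclusion_loadCeiling_of_bdd`), contradicting unbounded load. The window hypothesis is not
needed. [folklore] -/
theorem coherentWindowRegime_of_coherentScaleExclusion (hS2 : CoherentScaleExclusion) :
    ∀ δ : ℝ, 0 < δ → ∃ M : ℝ, ∀ T : ℝ, 0 < T →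
      ∀ (u : ℝ → EuclideanSpace ℝ (Fin 3) → EuclideanSpace ℝ (Fin 3)) (p : ℝ → EuclideanSpace ℝ (Fin 3) → ℝ),
      IsClassicalNSSolutionOn (Set.Ico 0 T) 1 0 u p →
      IsLerayHopfOn T 1 0 (u 0) u →
      HasRapidSpatialDecay (u 0) →
      ∀ x₀ : EuclideanSpace ℝ (Fin 3),
      (∃ M' : ℝ, ∀ r₁ : ℝ, 0 < r₁ → ∃ r ∈ Set.Ioo 0 r₁,
          cknC r ((T, x₀) : ℝ × EuclideanSpace ℝ (Fin 3)) u ≤ ENNReal.ofReal M') →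
      (∀ M'' r₁ : ℝ, 0 < r₁ → ∃ r ∈ Set.Ioo 0 r₁,
          ENNReal.ofReal M'' < cknC r ((T, x₀) : ℝ × EuclideanSpace ℝ (Fin 3)) u) →
      (∀ r₀ : ℝ, 0 < r₀ → ∃ r ∈ Set.Ioo 0 r₀,
          ENNReal.ofReal M ≤ cknC r ((T, x₀) : ℝ × EuclideanSpace ℝ (Fin 3)) u ∧
          ¬ DissipatesAtScale u T x₀ r δ) →
      False := by
  intro δ hδ
  obtain ⟨M, hM⟩ := hS2 δ hδ
  exact ⟨M, fun T hT u p hcl hLH hdec x₀ _ hunb hrec =>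
    coherentScaleExclusion_not_loadCeiling_of_unboundedLoad hunb
      (coherentScaleExclusion_loadCeiling_of_bdd (hM T hT u p hcl hLH hdec x₀ hrec))⟩

/-- **THE BIRTH CUT IS LOSSLESS: `S2 ↔ (A) ∧ (I) ∧ (B)`.** The crux is equivalent to the conjunction of the
statements of its three registered regime stubs (here for all `δ > 0`): `→` by
`coherentTypeIRegime_of_coherentScaleExclusion`, `coherentWindowRegime_of_coherentScaleExclusion`,
`cascadeRegime_of_coherentScaleExclusion`; `←` is the closed twin `coherentScaleExclusion_of_regimes`. Hence no
line for S2 avoids the cascade stub (B). [folklore] -/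
theorem coherentScaleExclusion_iff_regimes :
    CoherentScaleExclusion ↔
    ((∀ δ : ℝ, 0 < δ → ∃ M : ℝ, ∀ T : ℝ, 0 < T →
      ∀ (u : ℝ → EuclideanSpace ℝ (Fin 3) → EuclideanSpace ℝ (Fin 3)) (p : ℝ → EuclideanSpace ℝ (Fin 3) → ℝ),
      IsClassicalNSSolutionOn (Set.Ico 0 T) 1 0 u p →
      IsLerayHopfOn T 1 0 (u 0) u →
      HasRapidSpatialDecay (u 0) →
      ∀ x₀ : EuclideanSpace ℝ (Fin 3),
      (∃ M₁ r₁ : ℝ, 0 < r₁ ∧ ∀ r ∈ Set.Ioo 0 r₁,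
          cknC r ((T, x₀) : ℝ × EuclideanSpace ℝ (Fin 3)) u ≤ ENNReal.ofReal M₁) →
      (∀ r₀ : ℝ, 0 < r₀ → ∃ r ∈ Set.Ioo 0 r₀,
          ENNReal.ofReal M ≤ cknC r ((T, x₀) : ℝ × EuclideanSpace ℝ (Fin 3)) u ∧
          ¬ DissipatesAtScale u T x₀ r δ) →
      (∃ ρ : ℝ, 0 < ρ ∧ ∃ M : ℝ, ∀ t ∈ Set.Ioo (T - ρ ^ 2) T, ∀ x ∈ Metric.ball x₀ ρ, ‖u t x‖ ≤ M)) ∧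
    (∀ δ : ℝ, 0 < δ → ∃ M : ℝ, ∀ T : ℝ, 0 < T →
      ∀ (u : ℝ → EuclideanSpace ℝ (Fin 3) → EuclideanSpace ℝ (Fin 3)) (p : ℝ → EuclideanSpace ℝ (Fin 3) → ℝ),
      IsClassicalNSSolutionOn (Set.Ico 0 T) 1 0 u p →
      IsLerayHopfOn T 1 0 (u 0) u →
      HasRapidSpatialDecay (u 0) →
      ∀ x₀ : EuclideanSpace ℝ (Fin 3),
      (∃ M' : ℝ, ∀ r₁ : ℝ, 0 < r₁ → ∃ r ∈ Set.Ioo 0 r₁,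
          cknC r ((T, x₀) : ℝ × EuclideanSpace ℝ (Fin 3)) u ≤ ENNReal.ofReal M') →
      (∀ M'' r₁ : ℝ, 0 < r₁ → ∃ r ∈ Set.Ioo 0 r₁,
          ENNReal.ofReal M'' < cknC r ((T, x₀) : ℝ × EuclideanSpace ℝ (Fin 3)) u) →
      (∀ r₀ : ℝ, 0 < r₀ → ∃ r ∈ Set.Ioo 0 r₀,
          ENNReal.ofReal M ≤ cknC r ((T, x₀) : ℝ × EuclideanSpace ℝ (Fin 3)) u ∧
          ¬ DissipatesAtScale u T x₀ r δ) →
      False) ∧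
    (∀ δ : ℝ, 0 < δ → ∀ T : ℝ, 0 < T →
      ∀ (u : ℝ → EuclideanSpace ℝ (Fin 3) → EuclideanSpace ℝ (Fin 3)) (p : ℝ → EuclideanSpace ℝ (Fin 3) → ℝ),
      IsClassicalNSSolutionOn (Set.Ico 0 T) 1 0 u p →
      IsLerayHopfOn T 1 0 (u 0) u →
      HasRapidSpatialDecay (u 0) →
      ∀ x₀ : EuclideanSpace ℝ (Fin 3),
      (∀ M' : ℝ, ∃ r₁ : ℝ, 0 < r₁ ∧ ∀ r ∈ Set.Ioo 0 r₁,
          ENNReal.ofReal M' ≤ cknC r ((T, x₀) : ℝ × EuclideanSpace ℝ (Fin 3)) u) →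
      (∀ r₀ : ℝ, 0 < r₀ → ∃ r ∈ Set.Ioo 0 r₀, ¬ DissipatesAtScale u T x₀ r δ) →
      False)) :=
  ⟨fun hS2 => ⟨coherentTypeIRegime_of_coherentScaleExclusion hS2,
      coherentWindowRegime_of_coherentScaleExclusion hS2, cascadeRegime_of_coherentScaleExclusion hS2⟩,
    fun h => coherentScaleExclusion_of_regimes h.1 h.2.1 h.2.2⟩

/-! ## The unbounded-load form `S2_unb` of the crux -/

/-- **S2 implies its unbounded-load form `S2_unb`**: for every `δ > 0` there is `M` such that no final-time point
of a finite-energy classical solution from a rapidly decaying datum has unbounded load (`limsup_{r→0} C(r) = ∞`)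
together with recurrent `M`-loaded non-`δ`-mixing scales (S2 gives `BDD`, which caps the load). [folklore] -/
theorem unboundedLoadExclusion_of_coherentScaleExclusion (hS2 : CoherentScaleExclusion) :
    ∀ δ : ℝ, 0 < δ → ∃ M : ℝ, ∀ T : ℝ, 0 < T →
      ∀ (u : ℝ → EuclideanSpace ℝ (Fin 3) → EuclideanSpace ℝ (Fin 3)) (p : ℝ → EuclideanSpace ℝ (Fin 3) → ℝ),
      IsClassicalNSSolutionOn (Set.Ico 0 T) 1 0 u p →
      IsLerayHopfOn T 1 0 (u 0) u →
      HasRapidSpatialDecay (u 0) →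
      ∀ x₀ : EuclideanSpace ℝ (Fin 3),
      (∀ M'' r₁ : ℝ, 0 < r₁ → ∃ r ∈ Set.Ioo 0 r₁,
          ENNReal.ofReal M'' < cknC r ((T, x₀) : ℝ × EuclideanSpace ℝ (Fin 3)) u) →
      (∀ r₀ : ℝ, 0 < r₀ → ∃ r ∈ Set.Ioo 0 r₀,
          ENNReal.ofReal M ≤ cknC r ((T, x₀) : ℝ × EuclideanSpace ℝ (Fin 3)) u ∧
          ¬ DissipatesAtScale u T x₀ r δ) →
      False := by
  intro δ hδ
  obtain ⟨M, hM⟩ := hS2 δ hδ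
  exact ⟨M, fun T hT u p hcl hLH hdec x₀ hunb hrec =>
    coherentScaleExclusion_not_loadCeiling_of_unboundedLoad hunb
      (coherentScaleExclusion_loadCeiling_of_bdd (hM T hT u p hcl hLH hdec x₀ hrec))⟩

/-- **`S2_unb ↔ (I) ∧ (B)`**: the unbounded-load form is exactly the conjunction of the window regime and the
cascade regime of the birth cut. `→`: (I) carries unbounded load among its hypotheses; in (B) the load diverges
along all small scales, so it is unbounded (`coherentScaleExclusion_unboundedLoad_of_cascade`) and every small
scale is `M`-loaded, making the recurrent non-`δ`-mixing scales `M`-loaded. `←`: at a point of unbounded load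
either `C → ∞` (regime (B); drop the load from the recurrence) or bounded-load scales recur (regime (I)).
[folklore] -/
theorem unboundedLoadExclusion_iff_regimes :
    (∀ δ : ℝ, 0 < δ → ∃ M : ℝ, ∀ T : ℝ, 0 < T →
      ∀ (u : ℝ → EuclideanSpace ℝ (Fin 3) → EuclideanSpace ℝ (Fin 3)) (p : ℝ → EuclideanSpace ℝ (Fin 3) → ℝ),
      IsClassicalNSSolutionOn (Set.Ico 0 T) 1 0 u p →
      IsLerayHopfOn T 1 0 (u 0) u →
      HasRapidSpatialDecay (u 0) →
      ∀ x₀ : EuclideanSpace ℝ (Fin 3),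
      (∀ M'' r₁ : ℝ, 0 < r₁ → ∃ r ∈ Set.Ioo 0 r₁,
          ENNReal.ofReal M'' < cknC r ((T, x₀) : ℝ × EuclideanSpace ℝ (Fin 3)) u) →
      (∀ r₀ : ℝ, 0 < r₀ → ∃ r ∈ Set.Ioo 0 r₀,
          ENNReal.ofReal M ≤ cknC r ((T, x₀) : ℝ × EuclideanSpace ℝ (Fin 3)) u ∧
          ¬ DissipatesAtScale u T x₀ r δ) →
      False) ↔
    ((∀ δ : ℝ, 0 < δ → ∃ M : ℝ, ∀ T : ℝ, 0 < T →
      ∀ (u : ℝ → EuclideanSpace ℝ (Fin 3) → EuclideanSpace ℝ (Fin 3)) (p : ℝ → EuclideanSpace ℝ (Fin 3) → ℝ),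
      IsClassicalNSSolutionOn (Set.Ico 0 T) 1 0 u p →
      IsLerayHopfOn T 1 0 (u 0) u →
      HasRapidSpatialDecay (u 0) →
      ∀ x₀ : EuclideanSpace ℝ (Fin 3),
      (∃ M' : ℝ, ∀ r₁ : ℝ, 0 < r₁ → ∃ r ∈ Set.Ioo 0 r₁,
          cknC r ((T, x₀) : ℝ × EuclideanSpace ℝ (Fin 3)) u ≤ ENNReal.ofReal M') →
      (∀ M'' r₁ : ℝ, 0 < r₁ → ∃ r ∈ Set.Ioo 0 r₁,
          ENNReal.ofReal M'' < cknC r ((T, x₀) : ℝ × EuclideanSpace ℝ (Fin 3)) u) →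
      (∀ r₀ : ℝ, 0 < r₀ → ∃ r ∈ Set.Ioo 0 r₀,
          ENNReal.ofReal M ≤ cknC r ((T, x₀) : ℝ × EuclideanSpace ℝ (Fin 3)) u ∧
          ¬ DissipatesAtScale u T x₀ r δ) →
      False) ∧
    (∀ δ : ℝ, 0 < δ → ∀ T : ℝ, 0 < T →
      ∀ (u : ℝ → EuclideanSpace ℝ (Fin 3) → EuclideanSpace ℝ (Fin 3)) (p : ℝ → EuclideanSpace ℝ (Fin 3) → ℝ),
      IsClassicalNSSolutionOn (Set.Ico 0 T) 1 0 u p →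
      IsLerayHopfOn T 1 0 (u 0) u →
      HasRapidSpatialDecay (u 0) →
      ∀ x₀ : EuclideanSpace ℝ (Fin 3),
      (∀ M' : ℝ, ∃ r₁ : ℝ, 0 < r₁ ∧ ∀ r ∈ Set.Ioo 0 r₁,
          ENNReal.ofReal M' ≤ cknC r ((T, x₀) : ℝ × EuclideanSpace ℝ (Fin 3)) u) →
      (∀ r₀ : ℝ, 0 < r₀ → ∃ r ∈ Set.Ioo 0 r₀, ¬ DissipatesAtScale u T x₀ r δ) →
      False)) := by
  constructor
  · intro h
    refine ⟨fun δ hδ => ?_, fun δ hδ T hT u p hcl hLH hdec x₀ hcasc hrec => ?_⟩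
    · obtain ⟨M, hM⟩ := h δ hδ
      exact ⟨M, fun T hT u p hcl hLH hdec x₀ _ hunb hrec => hM T hT u p hcl hLH hdec x₀ hunb hrec⟩
    · obtain ⟨M, hM⟩ := h δ hδ
      -- in a pure cascade every scale below `r₁(M)` is `M`-loaded
      obtain ⟨r₁, hr₁, hload⟩ := hcasc M
      refine hM T hT u p hcl hLH hdec x₀ (coherentScaleExclusion_unboundedLoad_of_cascade hcasc) ?_
      intro r₀ hr₀
      obtain ⟨r, hr, hnot⟩ := hrec (min r₀ r₁) (lt_min hr₀ hr₁)
      exact ⟨r, ⟨hr.1, lt_of_lt_of_le hr.2 (min_le_left _ _)⟩,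
        hload r ⟨hr.1, lt_of_lt_of_le hr.2 (min_le_right _ _)⟩, hnot⟩
  · rintro ⟨hI, hB⟩ δ hδ
    obtain ⟨M, hM⟩ := hI δ hδ
    refine ⟨M, fun T hT u p hcl hLH hdec x₀ hunb hrec => ?_⟩
    by_cases hcasc : ∀ M' : ℝ, ∃ r₁ : ℝ, 0 < r₁ ∧ ∀ r ∈ Set.Ioo 0 r₁,
        ENNReal.ofReal M' ≤ cknC r ((T, x₀) : ℝ × EuclideanSpace ℝ (Fin 3)) u
    · exact hB δ hδ T hT u p hcl hLH hdec x₀ hcasc (fun r₀ hr₀ => (hrec r₀ hr₀).imp fun r hr => ⟨hr.1, hr.2.2⟩)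
    · exact hM T hT u p hcl hLH hdec x₀ (coherentScaleExclusion_windows_of_not_cascade hcasc) hunb hrec

/-- **`S2_unb ∧ S1_sup ⇒ S2`**: the unbounded-load form together with the sup-form of the sibling crux S1
(a load ceiling near `0` at a final-time point forces `BDD` — final-time centred Type-I exclusion, derived in
tree from `¬ TypeISingularityExists` by `supForm_of_not_typeISingularityExists`) gives back the crux: at a
point with `Recur(M,δ)` either there is a load ceiling (then `S1_sup`) or the load is unbounded (then `S2_unb`
refutes the recurrence). [folklore] -/
theorem coherentScaleExclusion_of_unboundedLoadExclusion_of_supForm :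
    (∀ δ : ℝ, 0 < δ → ∃ M : ℝ, ∀ T : ℝ, 0 < T →
      ∀ (u : ℝ → EuclideanSpace ℝ (Fin 3) → EuclideanSpace ℝ (Fin 3)) (p : ℝ → EuclideanSpace ℝ (Fin 3) → ℝ),
      Literature.Analysis.FluidPDE.IsClassicalNSSolutionOn (Set.Ico 0 T) 1 0 u p →
      Literature.Analysis.FluidPDE.IsLerayHopfOn T 1 0 (u 0) u →
      Literature.Analysis.FluidPDE.HasRapidSpatialDecay (u 0) →
      ∀ x₀ : EuclideanSpace ℝ (Fin 3),
      (∀ M'' r₁ : ℝ, 0 < r₁ → ∃ r ∈ Set.Ioo 0 r₁,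
          ENNReal.ofReal M'' < Literature.Analysis.FluidPDE.cknC r ((T, x₀) : ℝ × EuclideanSpace ℝ (Fin 3)) u) →
      (∀ r₀ : ℝ, 0 < r₀ → ∃ r ∈ Set.Ioo 0 r₀,
          ENNReal.ofReal M ≤ Literature.Analysis.FluidPDE.cknC r ((T, x₀) : ℝ × EuclideanSpace ℝ (Fin 3)) u ∧
          ¬ Literature.Analysis.FluidPDE.DissipatesAtScale u T x₀ r δ) →
      False) →
    (∀ M : ℝ, ∀ T : ℝ, 0 < T →
      ∀ (u : ℝ → EuclideanSpace ℝ (Fin 3) → EuclideanSpace ℝ (Fin 3)) (p : ℝ → EuclideanSpace ℝ (Fin 3) → ℝ),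
      Literature.Analysis.FluidPDE.IsClassicalNSSolutionOn (Set.Ico 0 T) 1 0 u p →
      Literature.Analysis.FluidPDE.IsLerayHopfOn T 1 0 (u 0) u →
      Literature.Analysis.FluidPDE.HasRapidSpatialDecay (u 0) →
      ∀ x₀ : EuclideanSpace ℝ (Fin 3),
      (∃ r₁ : ℝ, 0 < r₁ ∧ ∀ r ∈ Set.Ioo 0 r₁,
          Literature.Analysis.FluidPDE.cknC r ((T, x₀) : ℝ × EuclideanSpace ℝ (Fin 3)) u ≤ ENNReal.ofReal M) →
      ∃ ρ : ℝ, 0 < ρ ∧ ∃ M : ℝ, ∀ t ∈ Set.Ioo (T - ρ ^ 2) T, ∀ x ∈ Metric.ball x₀ ρ, ‖u t x‖ ≤ M) →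
    Summit.NavierStokesRegularity.NavierStokesRegularity.Theses.SelfMixingDichotomy.CoherentScaleExclusion := by
  intro hunbx hsup δ hδ
  obtain ⟨M, hM⟩ := hunbx δ hδ
  refine ⟨M, fun T hT u p hcl hLH hdec x₀ hrec => ?_⟩
  by_cases hceil : ∃ M₁ r₁ : ℝ, 0 < r₁ ∧ ∀ r ∈ Set.Ioo 0 r₁,
      cknC r ((T, x₀) : ℝ × EuclideanSpace ℝ (Fin 3)) u ≤ ENNReal.ofReal M₁
  · obtain ⟨M₁, r₁, hr₁, hC⟩ := hceil
    exact hsup M₁ T hT u p hcl hLH hdec x₀ ⟨r₁, hr₁, hC⟩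
  · exact (hM T hT u p hcl hLH hdec x₀ (coherentScaleExclusion_unboundedLoad_of_not_loadCeiling hceil) hrec).elim

/-- **Given `S1_sup`, the crux is EQUIVALENT to its unbounded-load form**: `S1_sup → (S2 ↔ S2_unb)`
(`→` needs nothing: `unboundedLoadExclusion_of_coherentScaleExclusion`). [folklore] -/
theorem coherentScaleExclusion_iff_unboundedLoadExclusion_of_supForm
    (hsup : ∀ M : ℝ, ∀ T : ℝ, 0 < T →
      ∀ (u : ℝ → EuclideanSpace ℝ (Fin 3) → EuclideanSpace ℝ (Fin 3)) (p : ℝ → EuclideanSpace ℝ (Fin 3) → ℝ),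
      Literature.Analysis.FluidPDE.IsClassicalNSSolutionOn (Set.Ico 0 T) 1 0 u p →
      Literature.Analysis.FluidPDE.IsLerayHopfOn T 1 0 (u 0) u →
      Literature.Analysis.FluidPDE.HasRapidSpatialDecay (u 0) →
      ∀ x₀ : EuclideanSpace ℝ (Fin 3),
      (∃ r₁ : ℝ, 0 < r₁ ∧ ∀ r ∈ Set.Ioo 0 r₁,
          Literature.Analysis.FluidPDE.cknC r ((T, x₀) : ℝ × EuclideanSpace ℝ (Fin 3)) u ≤ ENNReal.ofReal M) →
      ∃ ρ : ℝ, 0 < ρ ∧ ∃ M : ℝ, ∀ t ∈ Set.Ioo (T - ρ ^ 2) T, ∀ x ∈ Metric.ball x₀ ρ, ‖u t x‖ ≤ M) :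
    CoherentScaleExclusion ↔
    (∀ δ : ℝ, 0 < δ → ∃ M : ℝ, ∀ T : ℝ, 0 < T →
      ∀ (u : ℝ → EuclideanSpace ℝ (Fin 3) → EuclideanSpace ℝ (Fin 3)) (p : ℝ → EuclideanSpace ℝ (Fin 3) → ℝ),
      IsClassicalNSSolutionOn (Set.Ico 0 T) 1 0 u p →
      IsLerayHopfOn T 1 0 (u 0) u →
      HasRapidSpatialDecay (u 0) →
      ∀ x₀ : EuclideanSpace ℝ (Fin 3),
      (∀ M'' r₁ : ℝ, 0 < r₁ → ∃ r ∈ Set.Ioo 0 r₁,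
          ENNReal.ofReal M'' < cknC r ((T, x₀) : ℝ × EuclideanSpace ℝ (Fin 3)) u) →
      (∀ r₀ : ℝ, 0 < r₀ → ∃ r ∈ Set.Ioo 0 r₀,
          ENNReal.ofReal M ≤ cknC r ((T, x₀) : ℝ × EuclideanSpace ℝ (Fin 3)) u ∧
          ¬ DissipatesAtScale u T x₀ r δ) →
      False) :=
  ⟨unboundedLoadExclusion_of_coherentScaleExclusion,
    fun h => coherentScaleExclusion_of_unboundedLoadExclusion_of_supForm h hsup⟩

/-! ## Route level: the restated thesis needs S2 only in its unbounded-load form -/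

/-- **`P_quant ∧ S2_unb ∧ S1_sup ⇒` local boundedness at every final-time point** of every `ν = 1` finite-energy
classical solution from a rapidly decaying datum: `bdd_of_quantMixingPayoff` (S1 lead c3) with S2 recovered
from `S2_unb ∧ S1_sup` (`coherentScaleExclusion_of_unboundedLoadExclusion_of_supForm`). In the restated route
`P_quant ∧ S2 ∧ S1_sup` the structure crux S2 may therefore be replaced by `S2_unb ⇔ (I) ∧ (B)`: its Type-I
regime (A) is carried by `S1_sup`. [folklore] -/
theorem bdd_of_quantMixingPayoff_of_unboundedLoadExclusion : (∃ δ : ℝ, 0 < δ ∧ ∀ M : ℝ, ∃ K : ℝ, 2 ≤ K ∧ ∀ T : ℝ, 0 < T → ∀ (u : ℝ → EuclideanSpace ℝ (Fin 3) → EuclideanSpace ℝ (Fin 3)) (p : ℝ → EuclideanSpace ℝ (Fin 3) → ℝ), Literature.Analysis.FluidPDE.IsClassicalNSSolutionOn (Set.Ico 0 T) 1 0 u p → Literature.Analysis.FluidPDE.IsLerayHopfOn T 1 0 (u 0) u → Literature.Analysis.FluidPDE.HasRapidSpatialDecay (u 0) → ∀ x₀ : EuclideanSpace ℝ (Fin 3),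 ∀ r : ℝ, 0 < r → r ^ 2 ≤ T → Literature.Analysis.FluidPDE.cknC r ((T, x₀) : ℝ × EuclideanSpace ℝ (Fin 3)) u ≤ ENNReal.ofReal M → (∀ ρ ∈ Set.Ico (r / K) r, ENNReal.ofReal M ≤ Literature.Analysis.FluidPDE.cknC ρ ((T, x₀) : ℝ × EuclideanSpace ℝ (Fin 3)) u → (∀ θ : ℝ → EuclideanSpace ℝ (Fin 3) → ℝ, Literature.Analysis.FluidPDE.IsSmoothSpaceTimeOn (Set.Icc (T - ρ ^ 2) (T - ρ ^ 2 / 2)) θ → Literature.Analysis.FluidPDE.HasUniformRapidDecayOn (Set.Icc (T - ρ ^ 2) (T - ρ ^ 2 / 2)) θ → (∀ t ∈ (Set.Icc (T - ρ ^ 2) (T - ρ ^ 2 / 2)), ∀ x : EuclideanSpace ℝ (Fin 3), Literature.Analysis.FluidPDE.timeDerivWithin (Set.Icc (T - ρ ^ 2) (T - ρ ^ 2 / 2)) θ t x + inner ℝ (u t x) (gradient (θ t) x) = Laplacian.laplacian (θ t) x) → Function.support (θ (T - ρ ^ 2)) ⊆ Metric.ball x₀ ρ → ∫ x, (θ (T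 - ρ ^ 2 / 2) x) ^ 2 ≤ δ ^ 2 * ∫ x, (θ (T - ρ ^ 2) x) ^ 2)) → ∃ ρ ∈ Set.Icc (r / K) (r / 2), Literature.Analysis.FluidPDE.cknC ρ ((T, x₀) : ℝ × EuclideanSpace ℝ (Fin 3)) u ≤ ENNReal.ofReal M) →
    (∀ δ : ℝ, 0 < δ → ∃ M : ℝ, ∀ T : ℝ, 0 < T →
      ∀ (u : ℝ → EuclideanSpace ℝ (Fin 3) → EuclideanSpace ℝ (Fin 3)) (p : ℝ → EuclideanSpace ℝ (Fin 3) → ℝ),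
      IsClassicalNSSolutionOn (Set.Ico 0 T) 1 0 u p →
      IsLerayHopfOn T 1 0 (u 0) u →
      HasRapidSpatialDecay (u 0) →
      ∀ x₀ : EuclideanSpace ℝ (Fin 3),
      (∀ M'' r₁ : ℝ, 0 < r₁ → ∃ r ∈ Set.Ioo 0 r₁,
          ENNReal.ofReal M'' < cknC r ((T, x₀) : ℝ × EuclideanSpace ℝ (Fin 3)) u) →
      (∀ r₀ : ℝ, 0 < r₀ → ∃ r ∈ Set.Ioo 0 r₀,
          ENNReal.ofReal M ≤ cknC r ((T, x₀) : ℝ × EuclideanSpace ℝ (Fin 3)) u ∧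
          ¬ DissipatesAtScale u T x₀ r δ) →
      False) →
    (∀ M : ℝ, ∀ T : ℝ, 0 < T → ∀ (u : ℝ → EuclideanSpace ℝ (Fin 3) → EuclideanSpace ℝ (Fin 3)) (p : ℝ → EuclideanSpace ℝ (Fin 3) → ℝ), Literature.Analysis.FluidPDE.IsClassicalNSSolutionOn (Set.Ico 0 T) 1 0 u p → Literature.Analysis.FluidPDE.IsLerayHopfOn T 1 0 (u 0) u → Literature.Analysis.FluidPDE.HasRapidSpatialDecay (u 0) → ∀ x₀ : EuclideanSpace ℝ (Fin 3), (∃ r₁ : ℝ, 0 < r₁ ∧ ∀ r ∈ Set.Ioo 0 r₁, Literature.Analysis.FluidPDE.cknC r ((T, x₀) : ℝ × EuclideanSpace ℝ (Fin 3)) u ≤ ENNReal.ofReal M) → ∃ ρ : ℝ, 0 < ρ ∧ ∃ M : ℝ, ∀ t ∈ Set.Ioo (T - ρ ^ 2) T, ∀ x ∈ Metric.ball x₀ ρ, ‖u t x‖ ≤ M) →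
    ∀ T : ℝ, 0 < T → ∀ (u : ℝ → EuclideanSpace ℝ (Fin 3) → EuclideanSpace ℝ (Fin 3)) (p : ℝ → EuclideanSpace ℝ (Fin 3) → ℝ), Literature.Analysis.FluidPDE.IsClassicalNSSolutionOn (Set.Ico 0 T) 1 0 u p → Literature.Analysis.FluidPDE.IsLerayHopfOn T 1 0 (u 0) u → Literature.Analysis.FluidPDE.HasRapidSpatialDecay (u 0) → ∀ x₀ : EuclideanSpace ℝ (Fin 3), ∃ ρ : ℝ, 0 < ρ ∧ ∃ M : ℝ, ∀ t ∈ Set.Ioo (T - ρ ^ 2) T, ∀ x ∈ Metric.ball x₀ ρ, ‖u t x‖ ≤ M :=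
  fun hP hunbx hsup =>
    SequentialTypeIExclusion.Registered.bdd_of_quantMixingPayoff hP
      (coherentScaleExclusion_of_unboundedLoadExclusion_of_supForm hunbx hsup) hsup

/-- **The summit from `P_quant ∧ S2_unb ∧ ¬ TypeISingularityExists`**: as
`navierStokesRegularity_of_quantMixingPayoff` (S1 lead c3), with the structure crux S2 weakened to its
unbounded-load form (`S1_sup ⇐ ¬ TypeISingularityExists` by `supForm_of_not_typeISingularityExists`).
[folklore] -/
theorem navierStokesRegularity_of_quantMixingPayoff_of_unboundedLoadExclusion : (∃ δ : ℝ, 0 < δ ∧ ∀ M : ℝ, ∃ K : ℝ, 2 ≤ K ∧ ∀ T : ℝ, 0 < T → ∀ (u : ℝ → EuclideanSpace ℝ (Fin 3) → EuclideanSpace ℝ (Fin 3)) (p : ℝ → EuclideanSpace ℝ (Fin 3) → ℝ), Literature.Analysis.FluidPDE.IsClassicalNSSolutionOn (Set.Ico 0 T) 1 0 u p → Literature.Analysis.FluidPDE.IsLerayHopfOn T 1 0 (u 0) u → Literature.Analysis.FluidPDE.HasRapidSpatialDecay (u 0) → ∀ x₀ : EuclideanSpace ℝ (Fin 3), ∀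 r : ℝ, 0 < r → r ^ 2 ≤ T → Literature.Analysis.FluidPDE.cknC r ((T, x₀) : ℝ × EuclideanSpace ℝ (Fin 3)) u ≤ ENNReal.ofReal M → (∀ ρ ∈ Set.Ico (r / K) r, ENNReal.ofReal M ≤ Literature.Analysis.FluidPDE.cknC ρ ((T, x₀) : ℝ × EuclideanSpace ℝ (Fin 3)) u → (∀ θ : ℝ → EuclideanSpace ℝ (Fin 3) → ℝ, Literature.Analysis.FluidPDE.IsSmoothSpaceTimeOn (Set.Icc (T - ρ ^ 2) (T - ρ ^ 2 / 2)) θ → Literature.Analysis.FluidPDE.HasUniformRapidDecayOn (Set.Icc (T - ρ ^ 2) (T - ρ ^ 2 / 2)) θ → (∀ t ∈ (Set.Icc (T - ρ ^ 2) (T - ρ ^ 2 / 2)), ∀ x : EuclideanSpace ℝ (Fin 3), Literature.Analysis.FluidPDE.timeDerivWithin (Set.Icc (T - ρ ^ 2) (T - ρ ^ 2 / 2)) θ t x + inner ℝ (u t x) (gradient (θ t) x) = Laplacian.laplacian (θ t) x) → Function.support (θ (T - ρ ^ 2)) ⊆ Metric.ball x₀ ρ → ∫ x, (θ (T - ρ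 ^ 2 / 2) x) ^ 2 ≤ δ ^ 2 * ∫ x, (θ (T - ρ ^ 2) x) ^ 2)) → ∃ ρ ∈ Set.Icc (r / K) (r / 2), Literature.Analysis.FluidPDE.cknC ρ ((T, x₀) : ℝ × EuclideanSpace ℝ (Fin 3)) u ≤ ENNReal.ofReal M) →
    (∀ δ : ℝ, 0 < δ → ∃ M : ℝ, ∀ T : ℝ, 0 < T →
      ∀ (u : ℝ → EuclideanSpace ℝ (Fin 3) → EuclideanSpace ℝ (Fin 3)) (p : ℝ → EuclideanSpace ℝ (Fin 3) → ℝ),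
      IsClassicalNSSolutionOn (Set.Ico 0 T) 1 0 u p →
      IsLerayHopfOn T 1 0 (u 0) u →
      HasRapidSpatialDecay (u 0) →
      ∀ x₀ : EuclideanSpace ℝ (Fin 3),
      (∀ M'' r₁ : ℝ, 0 < r₁ → ∃ r ∈ Set.Ioo 0 r₁,
          ENNReal.ofReal M'' < cknC r ((T, x₀) : ℝ × EuclideanSpace ℝ (Fin 3)) u) →
      (∀ r₀ : ℝ, 0 < r₀ → ∃ r ∈ Set.Ioo 0 r₀,
          ENNReal.ofReal M ≤ cknC r ((T, x₀) : ℝ × EuclideanSpace ℝ (Fin 3)) u ∧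
          ¬ DissipatesAtScale u T x₀ r δ) →
      False) →
    ¬ Literature.Analysis.FluidPDE.TypeISingularityExists → _root_.NavierStokesRegularity :=
  fun hP hunbx hno =>
    SequentialTypeIExclusion.Registered.navierStokesRegularity_of_quantMixingPayoff hP
      (coherentScaleExclusion_of_unboundedLoadExclusion_of_supForm hunbx
        (SequentialTypeIExclusion.Registered.supForm_of_not_typeISingularityExists hno)) hno

end Summit.NavierStokesRegularity.NavierStokesRegularity.Theorems
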